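import Literature.Combinatorics.Sahi2008.Functional
import HarnessLib

/-!
# `NoHeavyLowerTail` (stmt-CriticalPhenomena-4575) — SUBSET (module) chord superlinearity of `E₃`: the statement

STATEMENT-FIRST file, seat `prim-l12-p5`, `--supports stmt-CriticalPhenomena-4575`.  One `@[conjecture]` definition
(`SubsetChordSuperlinear`, an obligation of THIS programme — the repaired form of `SahiChordSuperlinear.ChordSuperlinear`, which
is refuted at `k = 6` by `not_chordSuperlinear_five`) and two data definitions (`prodWeight`, `glue`); nothing is asserted.

For a finite index set `ι`, a product weight `w_q(x) = Π_i (q_i if x_i else 1 − q_i)` on `ι → Bool`, a triple `f` of monotone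
indicator functions and a set `S ⊆ ι` of coordinates, the SECTION of `f` at `x_S = v` is the triple `y ↦ f(v ⊔ y)` on
`{i ∉ S} → Bool`; the law of total `E₃` (tree `…SahiTotalE3`) reads
`E₃(f) = Σ_v w(v)·E₃(f | x_S = v) + E₃(E[f | x_S]) + Σ_a Cov(E[f_a|x_S], Cov(f_b,f_c|x_S))`.
`SubsetChordSuperlinear` (SCS):  for every such data with `|ι| ≥ 2` there is a NONEMPTY PROPER `S` with
  `E₃(f) ≥ Σ_{v ∈ {0,1}^S} w_q(v) · E₃^{w_q|Sᶜ}(f(v, ·))`   (= `E[E₃(f | x_S)]`).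
For `S = {j}` this is the per-coordinate statement FBP(j); "∃ j FBP(j)" is FALSE (`k = 6`: the star-α triple with doubled variables,
all six coordinates bad; dually the hexagon `C₆` with alternate terminals at `p = 1/3` — ttrl cp-sahi2, seat-verified), but on every
refuting instance found so far a good `S` exists and the minimal good `S` is a MODULE of the triple (a parallel class, a series path,
a block `B` through which all three events factor via one monotone `g(x_B)` — then `E₃(f | x_B) = E₃(f | g)` and SCS at `B` is FBP for
the quotient variable): census (exact) 92/92 cycle instances with `|S| ≤ 3`, doubled/tripled cube families (minimal good `|S|` = block
size), all `{0,1}^k`, `k ≤ 4` (where singletons suffice); ttrl census `p5-scs-subset-chord-superlinearity` running on module-free graphs.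
WHY IT MATTERS: SCS ⟹ Sahi's `C₃` / Kahn's Conjecture 5 for all product measures, by strong induction on `|ι|` (sections of monotone
indicator triples are monotone indicator triples on fewer coordinates; base `|ι| = 1` is the one-coin inequality) — the reduction is
the `S`-block analogue of `SahiChordSuperlinear.sahiPositive_three_of_chordSuperlinear` and is NOT yet formalised here (needs the
product/subtype splitting `(ι → Bool) ≃ (S → Bool) × (Sᶜ → Bool)`; recorded as the next step).
-/

namespace Summit.CriticalPhenomena.PercolationContinuityZ3.Theorems

namespace SahiSubsetChord

open Finset Literature.Combinatorics.Sahi2008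

variable {ι : Type*} [Fintype ι] [DecidableEq ι]

/-- The product weight `w_q(x) = Π_i (q_i if x_i else 1 − q_i)` on `ι → Bool`. [this file] -/
def prodWeight (q : ι → ℝ) (x : ι → Bool) : ℝ :=
  ∏ i, (if x i then q i else 1 - q i)

/-- Glue a configuration on `S` with one on its complement. [this file] -/
def glue (S : Finset ι) (v : {i // i ∈ S} → Bool) (y : {i // i ∉ S} → Bool) : ι → Bool :=
  fun i => if h : i ∈ S then v ⟨i, h⟩ else y ⟨i, h⟩

/-- **SUBSET (module) chord superlinearity of Sahi's `E₃`** — a conjecture OF THIS PROGRAMME (seat prim-l12-p5, 2026-08-20), the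
repaired form of the refuted per-coordinate `ChordSuperlinear`: on every finite cube with a product weight and every triple of
monotone indicator functions (at least two coordinates) some nonempty proper set `S` of coordinates satisfies
`E[E₃(f | x_S)] ≤ E₃(f)`.  NOT asserted; census-validated so far (module docstring); implies `C₃` for product measures by strong
induction on the number of coordinates. [this file] [status: open] -/
@[conjecture] def SubsetChordSuperlinear : Prop :=
  ∀ (ι : Type) [Fintype ι] [DecidableEq ι], 2 ≤ Fintype.card ι →
    ∀ (q : ι → ℝ), (∀ i, 0 ≤ q i ∧ q i ≤ 1) →
      ∀ f : Fin 3 → (ι → Bool) → ℝ, (∀ a x, f a x = 0 ∨ f a x = 1) → (∀ a, Monotone (f a)) →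
        ∃ S : Finset ι, S.Nonempty ∧ S ≠ Finset.univ ∧
          ∑ v : ({i // i ∈ S} → Bool),
              prodWeight (fun i : {i // i ∈ S} => q i) v *
                sahiE (prodWeight fun i : {i // i ∉ S} => q i) 3 (fun a y => f a (glue S v y))
            ≤ sahiE (prodWeight q) 3 f

end SahiSubsetChord

end Summit.CriticalPhenomena.PercolationContinuityZ3.Theorems
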